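import Literature.AlgebraicGeometry.HodgeTheory.GysinFormalism
import Literature.AlgebraicGeometry.HodgeTheory.GysinFormalismPushforward
import Literature.AlgebraicGeometry.Motives.CyclesAbelianVarietiesProofs
import Literature.AlgebraicGeometry.Motives.VarietiesGeometricallyIntegralProofs
import HarnessLib

/-!
# Route `SaitoKurokawaBridge`: the Prym correspondence is fibrewise degenerate — cohomological core
(helper for the INFORMAL support item `stmt-HodgeConjecture-3348`, `PrymCorrespondenceDegenerate`)

The item (route file rev 10: "informal only, no Lean statement yet") says, for a smooth genus-2 curve
`C/ℂ`, `η ∈ J(C)[2] ∖ 0`, `π : C_η → C` the étale double cover with deck involution `σ`, `ι̃` a lift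
of the hyperelliptic involution `ι`, `j := σ ι̃` and `ψ : C_η → E_η := C_η/⟨j⟩`: (i) `E_η` is an
elliptic curve, isogenous to the Prym variety of `π` (Kani–Rosen for the Klein group `⟨σ, ι̃⟩`);
(ii) the correspondence `(π, ψ) : C_η → C × E_η` is FIBREWISE DEGENERATE: `ψ_* ∘ π^* = 0` on `H¹`
(equivalently the `(1,1)`-Künneth component of `[C_η] ∈ H²(C × E_η)` vanishes) — the input of the
route's no-go Lemma (B) (`LerayTypeFilterPrym`) and of crux `PrymBridgePeriodVanishing`.

This file proves (ii) in the tree's vocabulary, relative to a Gysin formalism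
`G : Literature.AlgebraicGeometry.HodgeTheory.GysinFormalism` (the tree's idiom: hypothesis
structure taken as a parameter, `HodgeTheory/GysinFormalism`), and in the natural generality that
the classical proof uses — no genus, no `η`, no quotient construction is needed, only the
KLEIN-FOUR CONFIGURATION and the sign of `ι` on `H¹(C)`:

* `gysin_one_of_iso` — `j_* 1_Z = 1_{Z'}` for an isomorphism `j : Z ≅ Z'` of smooth projective
  varieties of equal dimension (from `cl_primeCycle` twice: `[Z'] = (𝟙)_* 1 = j_* 1`, and `(𝟙)_* = 𝟙`);
* `gysin_map_of_iso` — `j_* j^* = 𝟙` (projection formula with `y = 1`);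
* `gysin_eq_neg_of_map_eq_neg` — `j^* y = -y ⇒ j_* y = -y` for an automorphism `j`;
* `gysin_eq_zero_of_map_eq_neg` — if `j` is an automorphism of `Z` over `E` (`j ≫ q = q`) and
  `j^* y = -y` then `q_* y = 0` (`q_* y = (j ≫ q)_* y = q_* j_* y = -q_* y` in a `ℂ`-vector space);
* `map_comp_map_eq_neg` — `σ ≫ p = p`, `τ ≫ p = p ≫ ι`, `ι^* a = -a ⇒ (σ ≫ τ)^* p^* a = -p^* a`;
* `gysin_map_eq_zero_of_klein` — the two combined: `q_* p^* a = 0` (all degrees and dimensions);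
* `prymCorrespondence_gysin_comp_map_eq_zero` — THE ITEM'S (ii) for curves:
  `ψ_* ∘ π^* = 0 : H¹(C(ℂ); ℂ) → H¹(E_η(ℂ); ℂ)` as soon as `ι^* = -1` on `H¹(C(ℂ); ℂ)` (which holds
  for the hyperelliptic involution of a genus-2 curve: `H¹(C)^ι = H¹(C/ι) = H¹(ℙ¹) = 0`);
* `cl_cyclesOfDimMap_primeCycle`, `corrAct_cyclesOfDimMap_primeCycle_apply` — `cl(f_*[Z]) = f_* 1`
  and `[f_*[Z]]^* = (f ≫ pr_W)_* ∘ (f ≫ pr_X)^*` for the fundamental cycle of a smooth projective `Z`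
  pushed forward along any `f : Z ⟶ W ⊗ X` (appended section `CorrAct`);
* `corrAct_prymCycle_eq_zero`, `corrAct_prymCycle_transpose_eq_zero`,
  `corrAct_prymCycle_genericPoint_eq_zero` — THE ITEM'S (iii) in operator form: the correspondence
  actions `[(ψ,π)_*[C_η]]^* = ψ_* π^*` on `H¹(C)` and `[(π,ψ)_*[C_η]]^* = π_* ψ^*` on `H¹(E_η)` of the
  Prym cycle VANISH (its `H¹ ⊗ H¹`-Künneth component acts by zero), in the vocabulary `G.corrAct` of
  the route's no-go Lemma (A);
* `prymCorrespondence_transpose_eq_zero` — the transpose `π_* ∘ ψ^* = 0 : H¹(E_η) → H¹(C)`, from the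
  same lemma with the deck involution `σ` of `π`, which descends to `E_η` as an involution `ι_E`
  with `E_η/ι_E = C_η/⟨σ, ι̃⟩ ≅ ℙ¹`, hence `ι_E^* = -1` on `H¹(E_η)`.

Classical argument formalised (Mumford, *Prym varieties I* (1974) §1–2; Lange–Birkenhake,
*Complex Abelian Varieties*, §12.3–12.4: for `x ∈ H¹(C)`, `π^* x` is `σ`-invariant and
`ι̃^* π^* x = π^* ι^* x = -π^* x`, so `j^* π^* x = -π^* x`, while `ψ_*` factors over `j`-coinvariants).

NOT covered here (stated, not hidden): (i) of the item — `g(E_η) = 1` and `E_η ~ Prym(π)` (Kani–Rosen)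
— and the construction `η ↦ (C_η, σ, ι̃)`; the tree has `Motives/Jacobian`, `Motives/PrymVariety`
but no quotient of a curve by an involution, no `π^*` on Jacobians and no `J[2] ↔ {étale double
covers}`; these are the definition requests recorded in the route file ("Still wanted for the
informal items …: Jacobians/Pryms of curves with the Prym family R₂"). PROPOSED SIGNATURE for the
item's cohomological clause (ii), closable at once by `prymCorrespondence_gysin_comp_map_eq_zero`:
the statement of that theorem with `G, Z, C, E, hZ, hE, p, q, σ, τ, ι` universally quantified.
-/

-- `Summit.HodgeConjecture.HodgeConjecture.Theorems` is the mandated namespace (single-conjunct summit: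
-- Sub = Summit), which `linter.dupNamespace` flags; the lakefile turns the linter off tree-wide (weak
-- option), restated here so stand-alone elaboration is warning-free too.
set_option linter.dupNamespace false

noncomputable section

open CategoryTheory AlgebraicGeometry
open Literature.AlgebraicTopology.SingularHomology
open Literature.AlgebraicGeometry Literature.AlgebraicGeometry.HodgeTheory
  Literature.AlgebraicGeometry.Motives

namespace Summit.HodgeConjecture.HodgeConjecture.Theorems

variable (G : GysinFormalism)
variable {l n : ℕ} {Z Z' C E : SchemeOver ℂ}

/-- **Automorphisms preserve the fundamental class**: `j_* 1_Z = 1_{Z'}` for an isomorphism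
`j : Z ≅ Z'` of smooth projective varieties of the same dimension `n`. From the cycle-class field
`cl_primeCycle` of `G` twice — the prime cycle `[Z']` of the generic point of the integral scheme
`Z'` is both `(𝟙 Z')_* 1` and `j_* 1_Z` (identity and isomorphism are closed immersions with range
everything) — and `(𝟙)_* = 𝟙` (`gysin_id`). -/
theorem gysin_one_of_iso (hZ : IsSmoothProjective n Z) (hZ' : IsSmoothProjective n Z')
    (j : Z ≅ Z') :
    G.gysin hZ hZ' j.hom (rfl : 0 + 2 * n = 0 + 2 * n)
        (singularCohomology.one ℂ (ComplexPoints Z)) =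
      singularCohomology.one ℂ (ComplexPoints Z') := by
  haveI : IsIntegral Z'.left := IsSmoothProjective.isIntegral_holds hZ'
  have hmem : Motives.primeCycle (genericPoint Z'.left) ∈ Motives.cyclesOfDim Z'.left n :=
    Motives.primeCycle_mem_cyclesOfDim hZ'.height_genericPoint
  have hδ1 : IsGenericPoint (genericPoint Z'.left) (Set.range (𝟙 Z' : Z' ⟶ Z').left.base) := by
    have hr : Set.range (𝟙 Z' : Z' ⟶ Z').left.base = Set.univ :=
      Set.range_eq_univ.mpr fun x ↦ ⟨x, rfl⟩
    rw [hr]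
    exact genericPoint_spec Z'.left
  have hδ2 : IsGenericPoint (genericPoint Z'.left) (Set.range j.hom.left.base) := by
    rw [Set.range_eq_univ.mpr j.hom.left.surjective]
    exact genericPoint_spec Z'.left
  haveI : IsClosedImmersion (𝟙 Z' : Z' ⟶ Z').left :=
    (inferInstance : IsClosedImmersion (𝟙 Z'.left))
  have h1 := G.cl_primeCycle hZ' hZ' (𝟙 Z') (Nat.add_zero n) _ hδ1 hmem
  have h2 := G.cl_primeCycle hZ hZ' j.hom (Nat.add_zero n) _ hδ2 hmem
  have key : G.gysin hZ hZ' j.hom (rfl : 0 + 2 * n = 0 + 2 * n)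
      (singularCohomology.one ℂ (ComplexPoints Z)) =
      G.gysin hZ' hZ' (𝟙 Z') (rfl : 0 + 2 * n = 0 + 2 * n)
        (singularCohomology.one ℂ (ComplexPoints Z')) := h2.symm.trans h1
  rw [key, G.gysin_id hZ' 0, LinearMap.id_apply]

/-- **`j_* j^* = 𝟙` for an isomorphism** `j : Z ≅ Z'` of smooth projective varieties of the same
dimension: the projection formula `j_*(j^* x ∪ 1) = x ∪ j_* 1` (`gysin_cup`) and `j_* 1 = 1`
(`gysin_one_of_iso`), with `x ∪ 1 = x` (`cupProduct_one`). -/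
theorem gysin_map_of_iso (hZ : IsSmoothProjective n Z) (hZ' : IsSmoothProjective n Z')
    (j : Z ≅ Z') {a : ℕ} (x : complexBetti Z' a) :
    G.gysin hZ hZ' j.hom (rfl : a + 2 * n = a + 2 * n) (complexBetti.map j.hom a x) = x := by
  have h := G.gysin_cup hZ hZ' j.hom (Nat.add_zero a) (rfl : a + 2 * n = a + 2 * n)
    (rfl : 0 + 2 * n = 0 + 2 * n) (Nat.add_zero a) x (singularCohomology.one ℂ (ComplexPoints Z))
  rw [cupProduct_one, gysin_one_of_iso, cupProduct_one] at h
  exact h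

/-- **Anti-invariance passes from `j^*` to `j_*`**: for an automorphism `j` of a smooth projective
`Z` and a class `y` with `j^* y = -y`, also `j_* y = -y` (apply `j_* j^* = 𝟙` to `y`). -/
theorem gysin_eq_neg_of_map_eq_neg (hZ : IsSmoothProjective n Z) (j : Z ≅ Z) {a : ℕ}
    (y : complexBetti Z a) (hy : complexBetti.map j.hom a y = -y) :
    G.gysin hZ hZ j.hom (rfl : a + 2 * n = a + 2 * n) y = -y := by
  have h := gysin_map_of_iso G hZ hZ j y
  rw [hy, map_neg] at h
  exact neg_eq_iff_eq_neg.mp h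

/-- **Push-forward kills anti-invariant classes of a deck transformation**: for `q : Z ⟶ E`
(smooth projective, dimensions `l`, `n`) and an automorphism `j` of `Z` over `E` (`j ≫ q = q`),
every class `y ∈ Hᵃ(Z(ℂ); ℂ)` with `j^* y = -y` has `q_* y = 0` in `Hᵇ(E(ℂ); ℂ)`:
`q_* y = (j ≫ q)_* y = q_* (j_* y) = -q_* y` (`gysin_comp`, `gysin_eq_neg_of_map_eq_neg`), and
`v = -v ⇒ v = 0` in a `ℂ`-vector space. -/
theorem gysin_eq_zero_of_map_eq_neg (hZ : IsSmoothProjective l Z) (hE : IsSmoothProjective n E)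
    (q : Z ⟶ E) (j : Z ≅ Z) (hj : j.hom ≫ q = q) {a b : ℕ} (hab : a + 2 * n = b + 2 * l)
    (y : complexBetti Z a) (hy : complexBetti.map j.hom a y = -y) :
    G.gysin hZ hE q hab y = 0 := by
  have hcomp := G.gysin_comp hZ hZ hE j.hom q (rfl : a + 2 * l = a + 2 * l) hab
  have h : G.gysin hZ hE (j.hom ≫ q) hab y = G.gysin hZ hE q hab (G.gysin hZ hZ j.hom rfl y) :=
    LinearMap.congr_fun hcomp y
  simp only [hj] at h
  rw [gysin_eq_neg_of_map_eq_neg G hZ j y hy, map_neg] at h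
  have h2 : (2 : ℂ) • G.gysin hZ hE q hab y = 0 := by
    rw [two_smul]
    nth_rewrite 2 [h]
    exact add_neg_cancel _
  exact (smul_eq_zero.mp h2).resolve_left two_ne_zero

/-- **Pull-backs of `ι`-anti-invariant classes are anti-invariant under `σ ≫ τ`** when `σ` is a
symmetry of `p : Z ⟶ C` (`σ ≫ p = p`) and `τ` lifts the endomorphism `ι` of `C` (`τ ≫ p = p ≫ ι`):
`(σ ≫ τ)^* p^* a = ((σ ≫ τ) ≫ p)^* a = (p ≫ ι)^* a = p^* ι^* a = -p^* a` whenever `ι^* a = -a`.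
Pure functoriality of `f^*` (`complexBetti.map_comp`). -/
theorem map_comp_map_eq_neg (p : Z ⟶ C) (σ τ : Z ⟶ Z) (ι : C ⟶ C) (hσ : σ ≫ p = p)
    (hτ : τ ≫ p = p ≫ ι) {k : ℕ} (a : complexBetti C k) (ha : complexBetti.map ι k a = -a) :
    complexBetti.map (σ ≫ τ) k (complexBetti.map p k a) = -complexBetti.map p k a := by
  have hcomp : (σ ≫ τ) ≫ p = p ≫ ι := by rw [Category.assoc, hτ, ← Category.assoc, hσ]
  rw [← CategoryTheory.comp_apply, ← complexBetti.map_comp, hcomp, complexBetti.map_comp,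
    CategoryTheory.comp_apply, ha, map_neg]

/-- **The Klein-four (Prym) correspondence kills `ι`-anti-invariant classes** (all degrees and
dimensions). Data: smooth projective `Z` (dimension `l`) and `E` (dimension `n`) and a `ℂ`-scheme
`C`; morphisms `p : Z ⟶ C`, `q : Z ⟶ E`; automorphisms `σ`, `τ` of `Z` and an endomorphism `ι` of
`C` with `σ ≫ p = p` (`σ` is a deck transformation of `p`), `τ ≫ p = p ≫ ι` (`τ` lifts `ι`) and
`(σ ≫ τ) ≫ q = q` (`j := σ ≫ τ` is a deck transformation of `q`). Then `q_* p^* a = 0` in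
`Hᵇ(E(ℂ); ℂ)` for every class `a ∈ Hᵏ(C(ℂ); ℂ)` with `ι^* a = -a`
(`map_comp_map_eq_neg` + `gysin_eq_zero_of_map_eq_neg` for the automorphism `σ ≪≫ τ`). -/
theorem gysin_map_eq_zero_of_klein (hZ : IsSmoothProjective l Z) (hE : IsSmoothProjective n E)
    (p : Z ⟶ C) (q : Z ⟶ E) (σ τ : Z ≅ Z) (ι : C ⟶ C) (hσ : σ.hom ≫ p = p)
    (hτ : τ.hom ≫ p = p ≫ ι) (hq : (σ.hom ≫ τ.hom) ≫ q = q) {k b : ℕ} (hkb : k + 2 * n = b + 2 * l)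
    (a : complexBetti C k) (ha : complexBetti.map ι k a = -a) :
    G.gysin hZ hE q hkb (complexBetti.map p k a) = 0 :=
  gysin_eq_zero_of_map_eq_neg G hZ hE q (σ ≪≫ τ) (by simpa using hq) hkb _
    (by simpa using map_comp_map_eq_neg p σ.hom τ.hom ι hσ hτ a ha)

/-- **THE PRYM CORRESPONDENCE IS FIBREWISE DEGENERATE** (cohomological form on `H¹`, curves; clause
(ii) of support item `stmt-HodgeConjecture-3348` of route `SaitoKurokawaBridge`). Let `Z` ("`C_η`")
and `E` ("`E_η`") be smooth projective curves over `ℂ` and `C` a `ℂ`-scheme (the genus-2 curve),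
`p : Z ⟶ C` ("`π`") and `q : Z ⟶ E` ("`ψ`"); let `σ` be an automorphism of `Z` over `C` (the deck
involution of `π`), `τ` an automorphism of `Z` lifting an endomorphism `ι` of `C` ("`ι̃` lifts the
hyperelliptic involution `ι`"), and suppose `q` is invariant under `j := σ ≫ τ` (`E_η = C_η/⟨j⟩`).
If `ι` acts by `-1` on `H¹(C(ℂ); ℂ)` — as the hyperelliptic involution of a genus-2 curve does
(`H¹(C)^ι = H¹(ℙ¹) = 0`) — then `ψ_* ∘ π^* = 0 : H¹(C(ℂ); ℂ) → H¹(E_η(ℂ); ℂ)`: the correspondence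
`(π, ψ) : C_η → C × E_η` induces the zero map on `H¹`, i.e. its `(1,1)`-Künneth component vanishes
— it is fibrewise (cohomologically) degenerate, as no-go Lemma (B) of the route demands. Relative to
the Gysin formalism `G` (tree idiom); classical source: Mumford, *Prym varieties I* (1974), §1–2. -/
theorem prymCorrespondence_gysin_comp_map_eq_zero (hZ : IsSmoothProjective 1 Z)
    (hE : IsSmoothProjective 1 E) (p : Z ⟶ C) (q : Z ⟶ E) (σ τ : Z ≅ Z) (ι : C ⟶ C)
    (hσ : σ.hom ≫ p = p) (hτ : τ.hom ≫ p = p ≫ ι) (hq : (σ.hom ≫ τ.hom) ≫ q = q)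
    (hι : ∀ a : complexBetti C 1, complexBetti.map ι 1 a = -a) :
    G.gysin hZ hE q (rfl : 1 + 2 * 1 = 1 + 2 * 1) ∘ₗ (complexBetti.map p 1).hom = 0 := by
  ext a
  exact gysin_map_eq_zero_of_klein G hZ hE p q σ τ ι hσ hτ hq rfl a (hι a)

/-- **The transpose is degenerate too**: `π_* ∘ ψ^* = 0 : H¹(E_η(ℂ); ℂ) → H¹(C(ℂ); ℂ)`. Here `C`
and `Z` ("`C_η`") are smooth projective curves, `p : Z ⟶ C` ("`π`") has the deck automorphism `σ`
(`σ ≫ p = p`), and `σ` descends along `q : Z ⟶ E` ("`ψ`") to an endomorphism `ιE` of `E`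
(`σ ≫ q = q ≫ ιE`) acting by `-1` on `H¹(E(ℂ); ℂ)` — for the Prym cover, `σ` commutes with `j`, so it
descends to `E_η = C_η/⟨j⟩` as the involution with quotient `C_η/⟨σ, ι̃⟩ ≅ ℙ¹`. Then every
`ψ^* b` is `σ`-anti-invariant and `π_*` kills it (`gysin_map_eq_zero_of_klein` with `σ := 𝟙`,
`τ := σ`). -/
theorem prymCorrespondence_transpose_eq_zero (hZ : IsSmoothProjective 1 Z)
    (hC : IsSmoothProjective 1 C) (p : Z ⟶ C) (q : Z ⟶ E) (σ : Z ≅ Z) (ιE : E ⟶ E)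
    (hσ : σ.hom ≫ p = p) (hσq : σ.hom ≫ q = q ≫ ιE)
    (hιE : ∀ b : complexBetti E 1, complexBetti.map ιE 1 b = -b) :
    G.gysin hZ hC p (rfl : 1 + 2 * 1 = 1 + 2 * 1) ∘ₗ (complexBetti.map q 1).hom = 0 := by
  ext b
  exact gysin_map_eq_zero_of_klein G hZ hC q p (Iso.refl Z) σ ιE (by simp) (by simpa using hσq)
    (by simpa using hσ) rfl b (hιE b)

/-! ### Clause (iii), operator form: the action `[Γ]^*` of the Prym cycle on `H¹` vanishes
(appended 2026-08-16, same item) -/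

section CorrAct

open MonoidalCategory CartesianMonoidalCategory

variable {d m N : ℕ} {Y W X : SchemeOver ℂ}

/-- **The class of the push-forward of a fundamental cycle is the Gysin image of `1`**: for a
morphism `f : Z ⟶ Y` of smooth projective varieties (`dim Z = d`, `dim Y = N = d + e`) and the prime
cycle `[Z]` of the generic point `η` of `Z`, `cl(f_*[Z]) = f_*(1_Z)` — whatever the degree of `f` onto
its image (`f_*[Z] = deg(Z/f(Z))·[f(Z)]` or `0`, Fulton §1.4, is absorbed by `cl ∘ f_* = f_* ∘ cl`,
Prop. 9.21 (ii)), since `cl[Z] = (𝟙 Z)_* 1 = 1` (`cl_primeCycle`, `gysin_id`). -/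
theorem cl_cyclesOfDimMap_primeCycle (hZ : IsSmoothProjective d Z) (hY : IsSmoothProjective N Y)
    (f : Z ⟶ Y) [QuasiCompact f.left] {e : ℕ} (hde : d + e = N) (η : Z.left)
    (hηg : IsGenericPoint η Set.univ) (hη : Motives.primeCycle η ∈ Motives.cyclesOfDim Z.left d) :
    G.cl hY hde (Motives.cyclesOfDimMap d f.left ⟨Motives.primeCycle η, hη⟩) =
      G.gysin hZ hY f (show 0 + 2 * N = 2 * e + 2 * d by omega)
        (singularCohomology.one ℂ (ComplexPoints Z)) := by
  haveI : IsClosedImmersion (𝟙 Z : Z ⟶ Z).left := (inferInstance : IsClosedImmersion (𝟙 Z.left))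
  have hgen : IsGenericPoint η (Set.range (𝟙 Z : Z ⟶ Z).left.base) := by
    have hr : Set.range (𝟙 Z : Z ⟶ Z).left.base = Set.univ := Set.range_eq_univ.mpr fun x ↦ ⟨x, rfl⟩
    rw [hr]
    exact hηg
  rw [G.cl_map hZ hY f (Nat.add_zero d) hde, G.cl_primeCycle hZ hZ (𝟙 Z) (Nat.add_zero d) η hgen hη]
  exact congrArg (G.gysin hZ hY f _) (LinearMap.congr_fun (G.gysin_id hZ 0) _)

/-- **The action of a pushed-forward fundamental cycle**: for `f : Z ⟶ W ⊗ X` (`Z`, `W` smooth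
projective of the same dimension `m`, `X` of dimension `n`) and `Γ := f_*[Z] ∈ Z_m(W ⊗ X)`,
`[Γ]^*(c) = pr_{W*}(pr_X^* c ∪ f_* 1) = pr_{W*} f_*(f^* pr_X^* c ∪ 1) = (f ≫ pr_W)_*((f ≫ pr_X)^* c)`
on `Hᵏ(X(ℂ); ℂ) → Hᵏ(W(ℂ); ℂ)` — projection formula and functoriality (cf. the tree's
`corrActGen_primeCycle_eq`, which is the birational case). -/
theorem corrAct_cyclesOfDimMap_primeCycle_apply (hZ : IsSmoothProjective m Z)
    (hW : IsSmoothProjective m W) (hX : IsSmoothProjective n X) (f : Z ⟶ W ⊗ X)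
    [QuasiCompact f.left] (η : Z.left) (hηg : IsGenericPoint η Set.univ)
    (hη : Motives.primeCycle η ∈ Motives.cyclesOfDim Z.left m) (k : ℕ) (c : complexBetti X k) :
    G.corrAct hW hX k (Motives.cyclesOfDimMap m f.left ⟨Motives.primeCycle η, hη⟩) c =
      G.gysin hZ hW (f ≫ fst W X) (rfl : k + 2 * m = k + 2 * m)
        (complexBetti.map (f ≫ snd W X) k c) := by
  have hWX := IsSmoothProjective.tensor_holds hW hX
  rw [G.corrAct_apply, cl_cyclesOfDimMap_primeCycle G hZ hWX f rfl η hηg hη,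
    ← G.gysin_cup hZ hWX f (Nat.add_zero k) (show k + 2 * (m + n) = k + 2 * n + 2 * m by ring)
      (show 0 + 2 * (m + n) = 2 * n + 2 * m by ring) rfl,
    cupProduct_one, ← LinearMap.comp_apply (f := G.gysin hWX hW (fst W X) _)
      (g := G.gysin hZ hWX f _), ← G.gysin_comp hZ hWX hW f (fst W X), complexBetti.map_comp,
    CategoryTheory.comp_apply]

/-- **Clause (iii) of the item, operator form — the `H¹ → H¹` Künneth component of the Prym cycle
vanishes**: for the `1`-cycle `Γ := (ψ, π)_*[C_η] ∈ Z₁(E_η ⊗ C)` (push-forward of the fundamental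
cycle of `Z = "C_η"` along `(q, p) : Z ⟶ E ⊗ C`), the correspondence action
`[Γ]^* = ψ_* ∘ π^* : H¹(C(ℂ); ℂ) → H¹(E_η(ℂ); ℂ)` is ZERO, under the hypotheses of
`prymCorrespondence_gysin_comp_map_eq_zero` (`σ` deck automorphism of `π`, `τ` lifting `ι`,
`ψ` invariant under `σ ≫ τ`, `ι^* = -1` on `H¹(C)`). -/
theorem corrAct_prymCycle_eq_zero (hZ : IsSmoothProjective 1 Z) (hC : IsSmoothProjective 1 C)
    (hE : IsSmoothProjective 1 E) (p : Z ⟶ C) (q : Z ⟶ E) (σ τ : Z ≅ Z) (ι : C ⟶ C)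
    (hσ : σ.hom ≫ p = p) (hτ : τ.hom ≫ p = p ≫ ι) (hq : (σ.hom ≫ τ.hom) ≫ q = q)
    (hι : ∀ a : complexBetti C 1, complexBetti.map ι 1 a = -a)
    [QuasiCompact (lift q p).left] (η : Z.left) (hηg : IsGenericPoint η Set.univ)
    (hη : Motives.primeCycle η ∈ Motives.cyclesOfDim Z.left 1) :
    G.corrAct hE hC 1 (Motives.cyclesOfDimMap 1 (lift q p).left ⟨Motives.primeCycle η, hη⟩) = 0 := by
  ext a
  rw [corrAct_cyclesOfDimMap_primeCycle_apply G hZ hE hC (lift q p) η hηg hη 1 a,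
    LinearMap.zero_apply]
  simp only [lift_fst, lift_snd]
  exact gysin_map_eq_zero_of_klein G hZ hE p q σ τ ι hσ hτ hq rfl a (hι a)

/-- **Clause (iii), transposed — `[Γᵗ]^* = π_* ∘ ψ^* = 0 : H¹(E_η(ℂ); ℂ) → H¹(C(ℂ); ℂ)`** for
`Γᵗ := (π, ψ)_*[C_η] ∈ Z₁(C ⊗ E_η)`, under the hypotheses of `prymCorrespondence_transpose_eq_zero`
(`σ` deck automorphism of `π` descending along `ψ` to `ιE` with `ιE^* = -1` on `H¹(E_η)`). Together
with `corrAct_prymCycle_eq_zero`: the embedded curve `C_η → C × E_η` acts by zero on `H¹` in both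
directions, i.e. the `H¹ ⊗ H¹`-Künneth component of its class pairs to zero with everything. -/
theorem corrAct_prymCycle_transpose_eq_zero (hZ : IsSmoothProjective 1 Z)
    (hC : IsSmoothProjective 1 C) (hE : IsSmoothProjective 1 E) (p : Z ⟶ C) (q : Z ⟶ E)
    (σ : Z ≅ Z) (ιE : E ⟶ E) (hσ : σ.hom ≫ p = p) (hσq : σ.hom ≫ q = q ≫ ιE)
    (hιE : ∀ b : complexBetti E 1, complexBetti.map ιE 1 b = -b)
    [QuasiCompact (lift p q).left] (η : Z.left) (hηg : IsGenericPoint η Set.univ)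
    (hη : Motives.primeCycle η ∈ Motives.cyclesOfDim Z.left 1) :
    G.corrAct hC hE 1 (Motives.cyclesOfDimMap 1 (lift p q).left ⟨Motives.primeCycle η, hη⟩) = 0 := by
  ext b
  rw [corrAct_cyclesOfDimMap_primeCycle_apply G hZ hC hE (lift p q) η hηg hη 1 b,
    LinearMap.zero_apply]
  simp only [lift_fst, lift_snd]
  exact gysin_map_eq_zero_of_klein G hZ hC q p (Iso.refl Z) σ ιE (by simp) (by simpa using hσq)
    (by simpa using hσ) rfl b (hιE b)

/-- **The hypotheses are available for every smooth projective curve** `Z`: it is integral, its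
generic point `η` is generic in `univ` and `[Z] := [closure {η}]` is a `1`-cycle; and a morphism
`Z ⟶ W` to a smooth projective variety is proper, hence quasi-compact. Packaged instantiation of
`corrAct_prymCycle_eq_zero` at the generic point of `Z`. -/
theorem corrAct_prymCycle_genericPoint_eq_zero (hZ : IsSmoothProjective 1 Z)
    (hC : IsSmoothProjective 1 C) (hE : IsSmoothProjective 1 E) (p : Z ⟶ C) (q : Z ⟶ E)
    (σ τ : Z ≅ Z) (ι : C ⟶ C) (hσ : σ.hom ≫ p = p) (hτ : τ.hom ≫ p = p ≫ ι)
    (hq : (σ.hom ≫ τ.hom) ≫ q = q) (hι : ∀ a : complexBetti C 1, complexBetti.map ι 1 a = -a) :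
    ∃ (_ : IsIntegral Z.left) (_ : QuasiCompact (lift q p).left)
      (hη : Motives.primeCycle (genericPoint Z.left) ∈ Motives.cyclesOfDim Z.left 1),
      G.corrAct hE hC 1
        (Motives.cyclesOfDimMap 1 (lift q p).left ⟨Motives.primeCycle (genericPoint Z.left), hη⟩) = 0 := by
  haveI : IsIntegral Z.left := IsSmoothProjective.isIntegral_holds hZ
  haveI : QuasiCompact (lift q p).left := by
    haveI := isProper_left_of_isSmoothProjective hZ (IsSmoothProjective.tensor_holds hE hC) (lift q p)
    infer_instance
  exact ⟨inferInstance, inferInstance, Motives.primeCycle_mem_cyclesOfDim hZ.height_genericPoint,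
    corrAct_prymCycle_eq_zero G hZ hC hE p q σ τ ι hσ hτ hq hι _ (genericPoint_spec Z.left) _⟩

end CorrAct

end Summit.HodgeConjecture.HodgeConjecture.Theorems

end
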